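import Summits.QuantumAdvantage.QuantumAdvantage.Theorems.OddPrimeWalkSignWalkBounds

/-!
# OddPrimeWalk — sign-walk floor, sites: the item's sum as a sum of transfer products (item stmt-QuantumAdvantage-24332)

Route OddPrimeWalk (planner qa-qnc0-p2 g32, PROOF-BB); prover qn-prover-3 g20.  The site factors `FA` of the item at endpoint
residue `w` (active site `j`: `2[z + w = x_j] − 1`, a reflection in `z` and in `w`; inactive: `1`), their products over the
three endpoint residues (`prod_FA_const`, `prod_FA_shift` — the inputs of the parity core), the initial vector `v0`, the
item's signed sum `bbSum` (literal form) and the TRANSFER REPRESENTATION `bbSum_eq_sum_evo : bbSum = Σ_w ⟨δ_w, evo_k(F^w) v₀^w⟩`;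
the interior active sites and the free-block pigeonhole `exists_free_block`.  The floor itself: `OddPrimeWalkSignWalkFloor`.
-/

namespace Summit.QuantumAdvantage.AdviceFreeQNC0.SignWalk

open Finset

/-! ### The item's sum as a sum of transfer products -/

/-- Site factors of the item at endpoint residue `w`: an active site `j ∈ A` contributes `2[z + w = x_j] − 1`,
every other site `1`. -/
def FA (k : ℕ) (A : Finset (Fin (k + 1))) (x : Fin (k + 1) → ZMod 3) (w : ZMod 3) (j : ℕ) (z : ZMod 3) : ℝ :=
  if h : j < k + 1 then (if (⟨j, h⟩ : Fin (k + 1)) ∈ A then (if z + w = x ⟨j, h⟩ then 1 else -1) else 1) else 1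

/-- The factor of an active site is a reflection. -/
theorem FA_of_mem {k : ℕ} (A : Finset (Fin (k + 1))) (x : Fin (k + 1) → ZMod 3) (w : ZMod 3) (j : Fin (k + 1))
    (hj : j ∈ A) : FA k A x w j.val = refl (x j - w) := by
  funext z
  unfold FA refl
  rw [dif_pos j.isLt]
  simp only [Fin.eta, if_pos hj]
  by_cases h : z + w = x j
  · rw [if_pos h, if_pos (eq_sub_of_add_eq h)]
  · rw [if_neg h, if_neg]
    intro h'; apply h; rw [h']; ring

/-- The factor of an inactive site is `1`. -/
theorem FA_of_not_mem {k : ℕ} (A : Finset (Fin (k + 1))) (x : Fin (k + 1) → ZMod 3) (w : ZMod 3) (j : ℕ)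
    (hj : ∀ h : j < k + 1, (⟨j, h⟩ : Fin (k + 1)) ∉ A) : FA k A x w j = fun _ => 1 := by
  funext z
  unfold FA
  by_cases h : j < k + 1
  · rw [dif_pos h, if_neg (hj h)]
  · rw [dif_neg h]

/-- Site factors are `±1`. -/
theorem FA_pm (k : ℕ) (A : Finset (Fin (k + 1))) (x : Fin (k + 1) → ZMod 3) (w : ZMod 3) (j : ℕ) (z : ZMod 3) :
    FA k A x w j z = 1 ∨ FA k A x w j z = -1 := by
  unfold FA; split_ifs <;> simp

/-- Site factors are bounded by `1`. -/
theorem abs_FA_le (k : ℕ) (A : Finset (Fin (k + 1))) (x : Fin (k + 1) → ZMod 3) (w : ZMod 3) (j : ℕ)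
    (z : ZMod 3) : |FA k A x w j z| ≤ 1 := by
  rcases FA_pm k A x w j z with h | h <;> rw [h] <;> simp

/-- Over the three endpoint residues, a site factor with FROZEN argument multiplies to `1`. -/
theorem prod_FA_const (k : ℕ) (A : Finset (Fin (k + 1))) (x : Fin (k + 1) → ZMod 3) (j : ℕ) (p : ZMod 3) :
    ∏ w, FA k A x w j p = 1 := by
  by_cases h : j < k + 1
  · by_cases hA : (⟨j, h⟩ : Fin (k + 1)) ∈ A
    · have e : ∀ w, FA k A x w j p = refl (x ⟨j, h⟩ - p) w := by
        intro w
        have := congrFun (FA_of_mem A x w ⟨j, h⟩ hA) p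
        simp only at this
        rw [this, refl_apply, refl_apply]
        by_cases hw : w = x ⟨j, h⟩ - p
        · rw [if_pos hw, if_pos]; rw [hw]; ring
        · rw [if_neg hw, if_neg]; intro h'; apply hw; rw [h']; ring
      simp_rw [e]
      exact prod3_refl _
    · simp_rw [fun w => congrFun (FA_of_not_mem A x w j (fun h' => hA)) p]
      simp
  · simp_rw [fun w => congrFun (FA_of_not_mem A x w j (fun h' => absurd h' h)) p]
    simp

/-- `2w = c ↔ w = 2c` in `ℤ₃`. -/
theorem two_mul_eq_iff (w c : ZMod 3) : w + w = c ↔ w = 2 * c := by revert w c; decide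

/-- Over the three endpoint residues, a site factor with argument SHIFTING with the endpoint multiplies to `1`. -/
theorem prod_FA_shift (k : ℕ) (A : Finset (Fin (k + 1))) (x : Fin (k + 1) → ZMod 3) (j : ℕ) (r : ZMod 3) :
    ∏ w, FA k A x w j (w + r) = 1 := by
  by_cases h : j < k + 1
  · by_cases hA : (⟨j, h⟩ : Fin (k + 1)) ∈ A
    · have e : ∀ w, FA k A x w j (w + r) = refl (2 * (x ⟨j, h⟩ - r)) w := by
        intro w
        have := congrFun (FA_of_mem A x w ⟨j, h⟩ hA) (w + r)
        simp only at this
        rw [this, refl_apply, refl_apply]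
        have key : w + r = x ⟨j, h⟩ - w ↔ w = 2 * (x ⟨j, h⟩ - r) := by
          rw [← two_mul_eq_iff]
          constructor
          · intro h'; rw [← sub_eq_zero] at h' ⊢; rw [← h']; ring
          · intro h'; rw [← sub_eq_zero] at h' ⊢; rw [← h']; ring
        simp only [key]
      simp_rw [e]
      exact prod3_refl _
    · simp_rw [fun w => congrFun (FA_of_not_mem A x w j (fun h' => hA)) (w + r)]
      simp
  · simp_rw [fun w => congrFun (FA_of_not_mem A x w j (fun h' => absurd h' h)) (w + r)]
    simp

/-- The initial vector: `δ₀` times the factor of site `0`. -/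
def v0 (k : ℕ) (A : Finset (Fin (k + 1))) (x : Fin (k + 1) → ZMod 3) (w : ZMod 3) : ZMod 3 → ℝ :=
  fun z => if z = 0 then FA k A x w 0 0 else 0

/-- The item's signed sum `Σ_b Π_{j ∈ A} (2[z_j + z_k = x_j] − 1)` (literal form). -/
def bbSum (k : ℕ) (A : Finset (Fin (k + 1))) (x : Fin (k + 1) → ZMod 3) : ℝ :=
  ∑ b : Fin k → Bool, ∏ j ∈ A,
    (if (((univ.filter fun i : Fin k => i.val < j.val ∧ b i = true).card : ℕ) : ZMod 3) +
          (((univ.filter fun i : Fin k => b i = true).card : ℕ) : ZMod 3) = x j then (1 : ℝ) else -1)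

/-- **Transfer representation**: `bbSum = Σ_w ⟨δ_w, evo_k(F^w) v₀^w⟩`. -/
theorem bbSum_eq_sum_evo (k : ℕ) (A : Finset (Fin (k + 1))) (x : Fin (k + 1) → ZMod 3) :
    bbSum k A x = ∑ w, evo k (FA k A x w) (v0 k A x w) w := by
  unfold v0
  simp_rw [evo_delta_apply]
  rw [sum_comm]
  unfold bbSum
  refine sum_congr rfl fun b _ => ?_
  rw [sum_ite_eq]
  simp only [mem_univ, if_true]
  -- assemble the product over all sites `0, …, k`
  have hprod : FA k A x (wtZ k b) 0 0 * ∏ i ∈ range k, FA k A x (wtZ k b) (i + 1) (pre k b (i + 1))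
      = ∏ j ∈ range (k + 1), FA k A x (wtZ k b) j (pre k b j) := by
    rw [prod_range_succ' (fun j => FA k A x (wtZ k b) j (pre k b j)), pre_zero_site, mul_comm]
  rw [hprod, prod_range (fun j => FA k A x (wtZ k b) j (pre k b j))]
  have hsite : ∀ j : Fin (k + 1), FA k A x (wtZ k b) j.val (pre k b j.val)
      = if j ∈ A then (if pre k b j.val + wtZ k b = x j then 1 else -1) else 1 := by
    intro j; unfold FA; rw [dif_pos j.isLt]
  simp_rw [hsite]
  rw [prod_ite_mem, univ_inter]
  rfl

/-! ### Interior sites and free blocks -/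

/-- The interior active sites `1 ≤ j ≤ k − 1`. -/
def interior (k : ℕ) (A : Finset (Fin (k + 1))) : Finset (Fin (k + 1)) :=
  A.filter fun j => 1 ≤ j.val ∧ j.val + 1 ≤ k

/-- Fewer than `16` marked numbers leave one of the blocks `[qℓ+1, qℓ+ℓ]`, `q < 16`, unmarked. -/
theorem exists_free_block (I : Finset ℕ) (ℓ : ℕ) (hI : I.card < 16) :
    ∃ q, q < 16 ∧ ∀ j ∈ I, ¬ (q * ℓ + 1 ≤ j ∧ j ≤ q * ℓ + ℓ) := by
  by_contra hcon
  push Not at hcon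
  rcases Nat.eq_zero_or_pos ℓ with hℓ | hℓ
  · obtain ⟨j, _, hj⟩ := hcon 0 (by norm_num)
    omega
  · have hsub : range 16 ⊆ I.image fun j => (j - 1) / ℓ := by
      intro q hq
      rw [mem_range] at hq
      obtain ⟨j, hjI, hj1, hj2⟩ := hcon q hq
      rw [mem_image]
      refine ⟨j, hjI, ?_⟩
      apply le_antisymm
      · exact Nat.lt_succ_iff.mp ((Nat.div_lt_iff_lt_mul hℓ).mpr (by rw [Nat.succ_mul]; omega))
      · exact (Nat.le_div_iff_mul_le hℓ).mpr (by omega)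
    have := (card_le_card hsub).trans card_image_le
    simp at this
    omega

end Summit.QuantumAdvantage.AdviceFreeQNC0.SignWalk
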